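import Mathlib
import Summits.ValiantsHypothesis.ValiantsHypothesis.Theorems.LacunarySymmetroidMatrixDescartesCensusWindowFourWitnessCentre

/-!
# `MatrixDescartes` census — the WINDOW-4 BAND LAW (content of the registered stub `stub_w4Band` of the line `census`)

HONEST FRAMING.  Object-search cell `pub-symmetroid`, door-A target `DoorA26 := PosRootLawAt 2 6 19`
(stmt-ValiantsHypothesis-19979; OPEN, typed, never asserted).  The crux line `Cruxes/DoorA26/Lines/census.lean` registered
`stub_w4Band : Stmt.stub_w4Band := W4BandLaw` (desk D-0145: «stub_w4Band (door-p1 W4)»).  This file PROVES THE CONTENT, verbatim: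
for `u, v, w ≥ 1`, `c, e > 0`, interlacing data `0 < s₁ < s₂`, `T₂(s₁) = T₂(s₂) = 0`, `T₁(s₁) < 0 < T₁(s₂)`, and any test abscissa
`t > 0`: LEFT of the common centre (`(v+w)(u+v+w)·e·t^w ≤ v(u+v)·c`) `T₂(t) ≤ 0 ⟹ Φ(t) < 0`, RIGHT of it `Φ(t) ≤ 0 ⟹ T₂(t) < 0`
(`w4BandLaw_holds`; `T₁, T₂, Φ` as in `…CensusWindowFourInterlacing`).  Ingredients: the strict one-sided monotonicity of a
trinomial `α − βx^p + γx^q` (`γ > 0`) past a pivot on either side of its critical point (`trinomial_strictAntiOn_Icc`,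
`trinomial_strictMonoOn_Ici`, sharpening the non-strict versions of `…CensusWindowFourWitnessCentre`), the identity
`(u+v+w)·Φ(s) = u·T₁(s) + (v+w)·s^u·T₂(s)`, and the observation that `s₁` lies at or left and `s₂` at or right of the centre.
The stub itself is then one line (`theorem stub_w4Band : Stmt.stub_w4Band := w4BandLaw_holds`) in whichever file may import the
line's statement.  Nothing here bounds any census count; `DoorA26` OPEN; nothing on `MatrixDescartes` (stmt-18050) or `VP ≠ VNP`.

[folklore] Elementary calculus (derivative sign) + bookkeeping.
-/

-- `Summit.ValiantsHypothesis.ValiantsHypothesis.…` repeats a component by the D-0017 layout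
-- (single-conjunct summit), which the `dupNamespace` linter flags; the name is mandated.
set_option linter.dupNamespace false

namespace Summit.ValiantsHypothesis.ValiantsHypothesis.Theorems.LacunarySymmetroidMatrixDescartes.Census

open Polynomial Finset Set
open scoped BigOperators Polynomial

/-- STRICT one-sided monotonicity right of a pivot: `1 ≤ p < q`, `γ > 0`, `p·β ≤ q·γ·r^(q−p)`, `r > 0` ⇒ `α − βx^p + γx^q` is strictly
increasing on `[r, ∞)`. [folklore] -/
theorem trinomial_strictMonoOn_Ici {p q : ℕ} (hp : 0 < p) (hpq : p < q) {α β γ r : ℝ} (hγ : 0 < γ)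
    (hr : 0 < r) (hcen : (p : ℝ) * β ≤ (q : ℝ) * γ * r ^ (q - p)) :
    StrictMonoOn (fun x : ℝ => α - β * x ^ p + γ * x ^ q) (Ici r) := by
  apply strictMonoOn_of_deriv_pos (convex_Ici r) (Continuous.continuousOn (by fun_prop))
  intro x hx
  rw [interior_Ici] at hx
  have hxr : r < x := hx
  have hx0 : 0 < x := hr.trans hxr
  rw [(hasDerivAt_trinomial α β γ p q x).deriv]
  have hqp : q - 1 = (p - 1) + (q - p) := by omega
  have hqp0 : q - p ≠ 0 := by omega
  have hpow : r ^ (q - p) < x ^ (q - p) := pow_lt_pow_left₀ hxr hr.le hqp0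
  have hxp : 0 < x ^ (p - 1) := pow_pos hx0 _
  have hq : (0 : ℝ) < q := by exact_mod_cast hp.trans hpq
  rw [hqp, pow_add]
  have h2 : (q : ℝ) * γ * r ^ (q - p) < (q : ℝ) * γ * x ^ (q - p) :=
    mul_lt_mul_of_pos_left hpow (mul_pos hq hγ)
  nlinarith [mul_le_mul_of_nonneg_right hcen hxp.le, mul_lt_mul_of_pos_right h2 hxp]

/-- STRICT one-sided antitonicity left of a pivot: `1 ≤ p < q`, `γ > 0`, `q·γ·r^(q−p) ≤ p·β` ⇒ `α − βx^p + γx^q` is strictly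
decreasing on `[0, r]`. [folklore] -/
theorem trinomial_strictAntiOn_Icc {p q : ℕ} (hp : 0 < p) (hpq : p < q) {α β γ r : ℝ} (hγ : 0 < γ)
    (hcen : (q : ℝ) * γ * r ^ (q - p) ≤ (p : ℝ) * β) :
    StrictAntiOn (fun x : ℝ => α - β * x ^ p + γ * x ^ q) (Icc 0 r) := by
  apply strictAntiOn_of_deriv_neg (convex_Icc 0 r) (Continuous.continuousOn (by fun_prop))
  intro x hx
  rw [interior_Icc] at hx
  have hx0 : 0 < x := hx.1
  have hxr : x < r := hx.2
  rw [(hasDerivAt_trinomial α β γ p q x).deriv]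
  have hqp : q - 1 = (p - 1) + (q - p) := by omega
  have hqp0 : q - p ≠ 0 := by omega
  have hpow : x ^ (q - p) < r ^ (q - p) := pow_lt_pow_left₀ hxr hx0.le hqp0
  have hxp : 0 < x ^ (p - 1) := pow_pos hx0 _
  have hq : (0 : ℝ) < q := by exact_mod_cast hp.trans hpq
  rw [hqp, pow_add]
  have h2 : (q : ℝ) * γ * x ^ (q - p) < (q : ℝ) * γ * r ^ (q - p) :=
    mul_lt_mul_of_pos_left hpow (mul_pos hq hγ)
  nlinarith [mul_le_mul_of_nonneg_right hcen hxp.le, mul_lt_mul_of_pos_right h2 hxp]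

/-- **THE WINDOW-4 BAND LAW** — verbatim the statement `W4BandLaw` of the crux line `census` (stub `stub_w4Band`). [folklore] -/
theorem w4BandLaw_holds :
    ∀ (u v w : ℕ), 0 < u → 0 < v → 0 < w →
    ∀ (a b c e : ℝ), 0 < c → 0 < e →
    ∀ (s₁ s₂ : ℝ), 0 < s₁ → s₁ < s₂ →
      (u : ℝ) * b - ((u : ℝ) + v) * c * s₁ ^ v + ((u : ℝ) + v + w) * e * s₁ ^ (v + w) = 0 →
      (u : ℝ) * b - ((u : ℝ) + v) * c * s₂ ^ v + ((u : ℝ) + v + w) * e * s₂ ^ (v + w) = 0 →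
      ((u : ℝ) + v + w) * a - ((v : ℝ) + w) * b * s₁ ^ u + (w : ℝ) * c * s₁ ^ (u + v) < 0 →
      0 < ((u : ℝ) + v + w) * a - ((v : ℝ) + w) * b * s₂ ^ u + (w : ℝ) * c * s₂ ^ (u + v) →
      ∀ t : ℝ, 0 < t →
        ((((v : ℝ) + w) * ((u : ℝ) + v + w) * e * t ^ w ≤ (v : ℝ) * ((u : ℝ) + v) * c →
            (u : ℝ) * b - ((u : ℝ) + v) * c * t ^ v + ((u : ℝ) + v + w) * e * t ^ (v + w) ≤ 0 →
              (u : ℝ) * a - (v : ℝ) * c * t ^ (u + v) + ((v : ℝ) + w) * e * t ^ (u + v + w) < 0) ∧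
          ((v : ℝ) * ((u : ℝ) + v) * c ≤ ((v : ℝ) + w) * ((u : ℝ) + v + w) * e * t ^ w →
            (u : ℝ) * a - (v : ℝ) * c * t ^ (u + v) + ((v : ℝ) + w) * e * t ^ (u + v + w) ≤ 0 →
              (u : ℝ) * b - ((u : ℝ) + v) * c * t ^ v + ((u : ℝ) + v + w) * e * t ^ (v + w) < 0)) := by
  intro u v w hu hv hw a b c e hc he s₁ s₂ hs₁ hs₁₂ hT₂s₁ hT₂s₂ hT₁s₁ hT₁s₂ t ht
  -- the two concentric trinomials as functions
  set T₂ : ℝ → ℝ := fun x => (u : ℝ) * b - ((u : ℝ) + v) * c * x ^ v + ((u : ℝ) + v + w) * e * x ^ (v + w)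
    with hT₂def
  set Φ : ℝ → ℝ := fun x => (u : ℝ) * a - (v : ℝ) * c * x ^ (u + v) + ((v : ℝ) + w) * e * x ^ (u + v + w)
    with hΦdef
  have hs₂ : 0 < s₂ := hs₁.trans hs₁₂
  have hu' : (0 : ℝ) < u := by exact_mod_cast hu
  have hU : (0 : ℝ) < (u : ℝ) + v + w := by positivity
  -- Φ at the roots of T₂:  (u+v+w)·Φ(s) = u·T₁(s) + (v+w)·s^u·T₂(s)
  have key : ∀ s : ℝ, ((u : ℝ) + v + w) * Φ s
      = (u : ℝ) * (((u : ℝ) + v + w) * a - ((v : ℝ) + w) * b * s ^ u + (w : ℝ) * c * s ^ (u + v))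
        + ((v : ℝ) + w) * s ^ u * T₂ s := by
    intro s; simp only [hT₂def, hΦdef]; ring
  have hΦs₁ : Φ s₁ < 0 := by
    have h := key s₁
    have e1 : T₂ s₁ = 0 := hT₂s₁
    rw [e1, mul_zero, add_zero] at h
    have : ((u : ℝ) + v + w) * Φ s₁ < 0 := by rw [h]; exact mul_neg_of_pos_of_neg hu' hT₁s₁
    by_contra hge
    have := mul_nonneg hU.le (not_lt.mp hge)
    linarith
  have hΦs₂ : 0 < Φ s₂ := by
    have h := key s₂
    have e2 : T₂ s₂ = 0 := hT₂s₂
    rw [e2, mul_zero, add_zero] at h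
    have : 0 < ((u : ℝ) + v + w) * Φ s₂ := by rw [h]; exact mul_pos hu' hT₁s₂
    by_contra hle
    have := mul_nonpos_of_nonneg_of_nonpos (α := ℝ) hU.le (not_lt.mp hle)
    linarith
  -- exponent bookkeeping: for T₂, p = v, q = v + w; for Φ, p = u + v, q = u + v + w; q − p = w in both cases
  have hvw : v + w - v = w := by omega
  have huvw : u + v + w - (u + v) = w := by omega
  -- s₁ is at or LEFT of the centre, s₂ at or RIGHT of it
  have hs₁cen : ((v : ℝ) + w) * ((u : ℝ) + v + w) * e * s₁ ^ w ≤ (v : ℝ) * ((u : ℝ) + v) * c := by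
    by_contra hlt
    have hlt' : (v : ℝ) * ((u : ℝ) + v) * c < ((v : ℝ) + w) * ((u : ℝ) + v + w) * e * s₁ ^ w := lt_of_not_ge hlt
    -- then T₂ strictly increasing on [s₁, ∞): T₂(s₂) > T₂(s₁)
    have hmono := trinomial_strictMonoOn_Ici (α := (u : ℝ) * b) (β := ((u : ℝ) + v) * c)
      (γ := ((u : ℝ) + v + w) * e) (p := v) (q := v + w) hv (by omega) (by positivity) hs₁
      (by rw [hvw]; push_cast; linarith [hlt'])
    have h := hmono (Set.mem_Ici.mpr le_rfl) (Set.mem_Ici.mpr hs₁₂.le) hs₁₂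
    have e1 : T₂ s₁ = 0 := hT₂s₁
    have e2 : T₂ s₂ = 0 := hT₂s₂
    have : T₂ s₁ < T₂ s₂ := h
    rw [e1, e2] at this
    exact lt_irrefl _ this
  have hs₂cen : (v : ℝ) * ((u : ℝ) + v) * c ≤ ((v : ℝ) + w) * ((u : ℝ) + v + w) * e * s₂ ^ w := by
    by_contra hlt
    have hlt' : ((v : ℝ) + w) * ((u : ℝ) + v + w) * e * s₂ ^ w < (v : ℝ) * ((u : ℝ) + v) * c := lt_of_not_ge hlt
    have hanti := trinomial_strictAntiOn_Icc (α := (u : ℝ) * b) (β := ((u : ℝ) + v) * c)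
      (γ := ((u : ℝ) + v + w) * e) (p := v) (q := v + w) (r := s₂) hv (by omega) (by positivity)
      (by rw [hvw]; push_cast; linarith [hlt'])
    have h := hanti (show s₁ ∈ Icc (0 : ℝ) s₂ from ⟨hs₁.le, hs₁₂.le⟩) (show s₂ ∈ Icc (0 : ℝ) s₂ from ⟨hs₂.le, le_rfl⟩) hs₁₂
    have e1 : T₂ s₁ = 0 := hT₂s₁
    have e2 : T₂ s₂ = 0 := hT₂s₂
    have : T₂ s₂ < T₂ s₁ := h
    rw [e1, e2] at this
    exact lt_irrefl _ this
  refine ⟨?_, ?_⟩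
  · -- LEFT of centre: T₂(t) ≤ 0 ⟹ Φ(t) < 0
    intro htcen hT₂t
    have hT₂t' : T₂ t ≤ 0 := hT₂t
    -- s₁ ≤ t : otherwise T₂ is strictly decreasing on [0, s₁] and T₂(t) > T₂(s₁) = 0
    have hs₁t : s₁ ≤ t := by
      by_contra hlt
      have hts₁ : t < s₁ := lt_of_not_ge hlt
      have hanti := trinomial_strictAntiOn_Icc (α := (u : ℝ) * b) (β := ((u : ℝ) + v) * c)
        (γ := ((u : ℝ) + v + w) * e) (p := v) (q := v + w) (r := s₁) hv (by omega) (by positivity)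
        (by rw [hvw]; push_cast; linarith [hs₁cen])
      have h := hanti (show t ∈ Icc (0 : ℝ) s₁ from ⟨ht.le, hts₁.le⟩) (show s₁ ∈ Icc (0 : ℝ) s₁ from ⟨hs₁.le, le_rfl⟩) hts₁
      have e1 : T₂ s₁ = 0 := hT₂s₁
      have : T₂ s₁ < T₂ t := h
      rw [e1] at this
      exact absurd this (not_lt.mpr hT₂t')
    -- Φ strictly decreasing on [0, t]
    rcases hs₁t.lt_or_eq with hlt | heq
    · have hanti := trinomial_strictAntiOn_Icc (α := (u : ℝ) * a) (β := (v : ℝ) * c) (γ := ((v : ℝ) + w) * e)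
        (p := u + v) (q := u + v + w) (r := t) (Nat.add_pos_left hu v) (by omega) (by positivity)
        (by rw [huvw]; push_cast; linarith [htcen])
      have h := hanti (show s₁ ∈ Icc (0 : ℝ) t from ⟨hs₁.le, hlt.le⟩) (show t ∈ Icc (0 : ℝ) t from ⟨ht.le, le_rfl⟩) hlt
      have : Φ t < Φ s₁ := h
      exact this.trans hΦs₁
    · rw [← heq]; exact hΦs₁
  · -- RIGHT of centre: Φ(t) ≤ 0 ⟹ T₂(t) < 0
    intro htcen hΦt
    have hΦt' : Φ t ≤ 0 := hΦt
    -- t < s₂ : otherwise Φ is strictly increasing on [s₂, ∞) and Φ(t) ≥ Φ(s₂) > 0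
    have hts₂ : t < s₂ := by
      by_contra hle
      have hs₂t : s₂ ≤ t := not_lt.mp hle
      rcases hs₂t.lt_or_eq with hlt | heq
      · have hmono := trinomial_strictMonoOn_Ici (α := (u : ℝ) * a) (β := (v : ℝ) * c) (γ := ((v : ℝ) + w) * e)
          (p := u + v) (q := u + v + w) (Nat.add_pos_left hu v) (by omega) (by positivity) hs₂
          (by rw [huvw]; push_cast; linarith [hs₂cen])
        have h := hmono (Set.mem_Ici.mpr le_rfl) (Set.mem_Ici.mpr hlt.le) hlt
        have : Φ s₂ < Φ t := h
        exact absurd (hΦs₂.trans this) (not_lt.mpr hΦt')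
      · rw [← heq] at hΦt'; exact absurd hΦs₂ (not_lt.mpr hΦt')
    have hmono := trinomial_strictMonoOn_Ici (α := (u : ℝ) * b) (β := ((u : ℝ) + v) * c)
      (γ := ((u : ℝ) + v + w) * e) (p := v) (q := v + w) hv (by omega) (by positivity) ht
      (by rw [hvw]; push_cast; linarith [htcen])
    have h := hmono (Set.mem_Ici.mpr le_rfl) (Set.mem_Ici.mpr hts₂.le) hts₂
    have e2 : T₂ s₂ = 0 := hT₂s₂
    have : T₂ t < T₂ s₂ := h
    exact lt_of_lt_of_eq this e2

end Summit.ValiantsHypothesis.ValiantsHypothesis.Theorems.LacunarySymmetroidMatrixDescartes.Census
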